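/-
Copyright (c) 2026 the pub-hodgecm-mathlib formalisation cell (harness21).  Prover seat hodgecm-mathlib-R90-C10-p06 (g4), SLAB R90-TF, section S1 «Ch. 10∕12 local»;
crux H413 = `stmt-HodgeConjecture-24833`; line «B_pos» WILD corner (S-W), R-S1-51 (1)(ii) PART A (dealer R90-C10-plan (g4)): «THE LINE COSET LAW» — the place-free,
`2`-free engine of P-WILD-1 v2 §2 (`R90/R90-C10-p06/g4/P-WILD-1.v2.md` ae6d65105786364d).  KERNEL module: THEOREMS ONLY (no definition, no named fact, no `sorry`,
no instance, no notation).  2026-09-05.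
-/
import Summits.HodgeConjecture.HodgeConjecture.Theorems.R90S1BposRamSkewLineCayley   -- ★ (5) p864… (R90-C10-p04 (g3)): the TAME template §2 `setIntegral_skewBallTranslate_dite_add_eq_of_fixedPrincipal`; brings ★ PART 1∕2 tools, ★ `HeisRing` skew-part kit (`smulSkew`, `skewModulus_eq_sqrt`), ★ `exists_conjLocal_skew_unit`, ★ `valued_units_inv_apply_eq_one`, ★ `forall_placesOver_of_apply`
import HarnessLib

/-!
# R90-TF S1 «Ch10-local» ∕ K2 E3 «U4Keys» :182, BRANCH B, WILD corner (S-W) — PART A of the line ball law: THE LINE COSET LAW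
# «`∫_{|y|_w ≤ r} E(â + g·y) dμ⁻ = E(â) · ∫_{|y|_w ≤ r} E(1 + g·y) dμ⁻`» for a σ-FIXED unit `a` of modulus one — PLACE-FREE, `2`-FREE (no `|2|_w = 1`, no `hfixP`)
# [Keys1984 §4, §7 Thm (2); WeilBNT1967 Ch. II §5; Serre1979 Ch. V §3]

Cell `pub/hodgecm-mathlib`, crux H413 = `stmt-HodgeConjecture-24833`, route of record `HCCMUnconditional` (no route verbs); R90-TF section S1 (base R90-C10), dealer
R90-C10-plan (g4) (R-S1-51 (1)(ii) ∕ R-S1-52 (A), 2026-09-05T04:14–04:16Z), line lead R90-C10-p05 (g3), auditor R90-C10-audit1 (g4).  THEOREMS ONLY; lane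
`--supports stmt-HodgeConjecture-24833 --as helper`, count-neutral.  NOT THE PAYER of :182.

THE POINT (P-WILD-1 v2 §2, «what survives of (P0)–(P2) — NO Cayley law needed»).  At a WILDLY ramified place the tame factorisation of the principal units along the skew
line, `U_E^{(m)} = (1 + 𝔭_F)·(1 + E⁻_m)` with `χ₁ = 1` on `1 + 𝔭_F` (★ (5) under `hfixP`, `|2|_w = 1`), is replaced by the factorisation along the WILD SKEW LINES `ℓ± = t^{±1}·E⁻`
(`t` the minimal trace-one element, ★ (W-0)): `U_E^{(m)} = (1 + 𝔭_F^{⌈m∕2⌉})·(1 + ℓ±_m)`, where now the `F`-factor `χ₁(1+f) = ε₁(1+f)` is NOT killed (`ε₁ = χ₁|_{𝒪_F^×} ∈ {1, ω_{E∕F}}`,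
and in sub-branch (R-b) `ω` has conductor `d ≥ 2`).  The one analytic identity both sub-branches need is therefore the COSET LAW WITH THE FACTOR RETAINED: for a σ-fixed unit `a`
of modulus one, ANY direction `g ∈ R` (the line is `g·R⁻`; `g = t⁻¹` resp. `t` for `ℓ∓`) and ANY radius,
  `∫_{y ∈ R⁻, |y|_w ≤ r} E(â + g·y) dμ⁻(y) = E(â) · ∫_{y ∈ R⁻, |y|_w ≤ r} E(1 + g·y) dμ⁻(y)`,   `E(r) := χ₁(r̂)` if `r` is a unit, else `0`
— because `â + g·y = â·(1 + g·(â⁻¹y))`, `E` is multiplicative against UNITS with no valuation hypothesis (a non-unit times a unit is a non-unit), and `y ↦ â⁻¹y` is a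
`μ⁻`-preserving automorphism of `R⁻` (★ `HeisRing.smulSkew`, modulus `unitModulusChar â⁻¹ = 1`) preserving every ball `{|y|_w ≤ r}`.  No `|2|_w = 1`, no `hfixP`, no trace-one
element, no hypothesis on `g` or `r`: this is ★ (5) §2 with its `hχâ : χ₁ â = 1` step DELETED and the factor carried through.  In (R-a) the factor is `1` and the law IS the
tame one; in (R-b) it is `ω(a)` and feeds the Tate Gauss sum of P-WILD-1 §3 (Y).
* §1 `dite_units_mul_eq` — `E(â·r) = E(â)·E(r)` for every `r : R` (units: `χ₁` multiplicative; non-units: both sides `0`).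
* §2 `setIntegral_skewBall_comp_unitsInv_mul_eq` — `∫_{|y|_w ≤ r} F(â⁻¹·y) dμ⁻ = ∫_{|y|_w ≤ r} F(y) dμ⁻` for a σ-fixed unit `a` with `|a_w| = 1` and every `F : R⁻ → ℂ` (★ `smulSkew`
  measure preservation at modulus one + ball invariance; the measurable-embedding change of variables, as ★ (5) §2).
* §3 **`setIntegral_skewBall_dite_units_add_mul_eq`** — THE LINE COSET LAW above; + `setIntegral_skewBall_dite_one_add_fixed_add_mul_eq`, the additive-coset form
  `∫ E(1 + f + g·y) = E(1+f)·∫ E(1 + (g·(1+f)⁻¹… )` is NOT needed: consumers factor `1 + f + u = (1+f)(1 + u∕(1+f))` themselves and call §3 with `â := (1+f)^`.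
HONEST LABEL.  HC_CM is proved only modulo the 7 printed citations (2 remaining named inputs: hLiu418 = `stmt-HodgeConjecture-24832`, h413 = `stmt-HodgeConjecture-24833`) until
rung 0 closes; count-neutral — this file pays NO socket ((S-W) ∕ :182 ∕ A2′ OPEN); no printed citation is discharged; REL ≠ ★ ≠ BUILT.

## References
* [Keys1984] D. Keys, *Principal series representations of special unitary groups over local fields*, Compositio Math. 51 (1984), §4, §5 Thm (2), §7 Theorem (2) p. 126.
* [WeilBNT1967] A. Weil, *Basic Number Theory* (1967), Ch. II §5 (Haar measure and modulus under automorphisms).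
* [Serre1979] J.-P. Serre, *Local Fields* (1979), Ch. V §3 (the norm groups `N(U_E^{ψ(n)})` of a ramified quadratic extension; why the `F`-factor survives wildly).
-/

set_option autoImplicit false
-- the mandated namespace has the single-problem summit's repeated segment (`HodgeConjecture.HodgeConjecture`)
set_option linter.dupNamespace false

noncomputable section

open NumberField IsDedekindDomain MeasureTheory Measure Topology Set
open scoped NNReal ENNReal
open Literature.NumberTheory Literature.NumberTheory.Automorphic Literature.NumberTheory.Automorphic.UnitaryGroup

namespace Summit.HodgeConjecture.HodgeConjecture.R90.S1.WildLineCosetLaw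

open Summit.HodgeConjecture.HodgeConjecture.Cruxes.H413
open Summit.HodgeConjecture.HodgeConjecture.Cruxes.H413.K2E3BranchBSkewUnitSign
open Summit.HodgeConjecture.HodgeConjecture.Cruxes.H413.K2E3BranchBSkewLineIntegrals
open Summit.HodgeConjecture.HodgeConjecture.Cruxes.H413.K2E3BranchBSkewLineCharacterIntegral
open Summit.HodgeConjecture.HodgeConjecture.R90.S1.BposSkewBallCharacterTools
open Summit.HodgeConjecture.HodgeConjecture.R90.S1.BposSkewLineCharacterIntegralDepth

variable (L : Type) [Field L] [NumberField L] [IsCMField L] (v : HeightOneSpectrum (𝓞 ↥(maximalRealSubfield L)))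
  (w : PlacesOver L v) (hw : IsCMField.complexConj L • w.1 = w.1)

/-! ## §1 `E` is multiplicative against units, with NO valuation hypothesis -/

open scoped Classical in
omit [IsCMField L] w hw in
/-- **`E(â·r) = E(â)·E(r)`** for a unit `a` and ANY `r : R` (`E(r) = χ₁(r̂)` on units, `0` off units): if `r` is a unit so is `â·r` and `χ₁` is multiplicative; if not, neither
is `â·r`. [cite: WeilBNT1967, Ch. II §5] -/
theorem dite_units_mul_eq (χ₁ : (LocalRing L v)ˣ →* ℂˣ) (a : (LocalRing L v)ˣ) (r : LocalRing L v) :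
    (fun r : LocalRing L v => if h : IsUnit r then ((χ₁ h.unit : ℂˣ) : ℂ) else 0) ((a : LocalRing L v) * r) =
      ((χ₁ a : ℂˣ) : ℂ) * (fun r : LocalRing L v => if h : IsUnit r then ((χ₁ h.unit : ℂˣ) : ℂ) else 0) r := by
  by_cases hr : IsUnit r
  · have har : IsUnit ((a : LocalRing L v) * r) := a.isUnit.mul hr
    simp only [dif_pos hr, dif_pos har]
    have hunits : har.unit = a * hr.unit := Units.ext (by rw [har.unit_spec, Units.val_mul, hr.unit_spec])
    rw [hunits, map_mul, Units.val_mul]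
  · have har : ¬ IsUnit ((a : LocalRing L v) * r) := fun h => hr (by
      have h' : IsUnit (((a⁻¹ : (LocalRing L v)ˣ) : LocalRing L v) * ((a : LocalRing L v) * r)) := (a⁻¹).isUnit.mul h
      rwa [← mul_assoc, Units.inv_mul, one_mul] at h')
    simp only [dif_neg hr, dif_neg har, mul_zero]

section SkewBall

variable [MeasurableSpace (LocalRing L v)] [BorelSpace (LocalRing L v)]
  (μY : Measure ↥(HeisRing.skewPart (conjLocal L (IsCMField.complexConj L) v))) [μY.IsAddHaarMeasure] [μY.Regular]

/-! ## §2 The substitution `y ↦ â⁻¹y` on a skew ball, for a σ-fixed unit `a` of modulus one -/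

include hw in
/-- **`∫_{|y|_w ≤ r} F(â⁻¹·y) dμ⁻(y) = ∫_{|y|_w ≤ r} F(y) dμ⁻(y)`** for a σ-fixed unit `a` with `|a_w| = 1`, every `F : R⁻ → ℂ` and every radius `r`: `y ↦ â⁻¹y` is the topological
additive automorphism ★ `HeisRing.smulSkew` of `R⁻` (`â⁻¹` is σ-fixed), it preserves `μ⁻` because its modulus is `unitModulusChar â⁻¹ = 1` (★ `skewModulus_eq_sqrt`, `|a_{w′}| = 1`
at every `w′` from the single place, ★ `forall_placesOver_of_apply`), and it preserves the ball (`|â⁻¹y|_w = |y|_w`). ★ (5) §2's change of variables, verbatim minus the centre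
`t₀`. [cite: WeilBNT1967, Ch. II §5] -/
theorem setIntegral_skewBall_comp_unitsInv_mul_eq (a : (LocalRing L v)ˣ)
    (ha : conjLocal L (IsCMField.complexConj L) v (a : LocalRing L v) = a) (hav : Valued.v ((a : LocalRing L v) w) = 1)
    (F : ↥(HeisRing.skewPart (conjLocal L (IsCMField.complexConj L) v)) → ℂ) (r : w.1.adicCompletion L) :
    ∫ y in {y : ↥(HeisRing.skewPart (conjLocal L (IsCMField.complexConj L) v)) | Valued.v ((y : LocalRing L v) w) ≤ Valued.v r},
        F (HeisRing.smulSkew (conjLocal L (IsCMField.complexConj L) v) (a⁻¹) (HeisRing.map_units_inv_of_fixed (conjLocal L (IsCMField.complexConj L) v) a ha) y) ∂μY =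
      ∫ y in {y : ↥(HeisRing.skewPart (conjLocal L (IsCMField.complexConj L) v)) | Valued.v ((y : LocalRing L v) w) ≤ Valued.v r}, F y ∂μY := by
  haveI : SecondCountableTopology (LocalRing L v) := secondCountableTopology_localRing (E := L) v
  have hσ := conjLocal_conjLocal_cm L v
  have hσc := continuous_conjLocal L (IsCMField.complexConj L) v
  have hainvfix : conjLocal L (IsCMField.complexConj L) v (((a⁻¹ : (LocalRing L v)ˣ)) : LocalRing L v) = ((a⁻¹ : (LocalRing L v)ˣ) : LocalRing L v) :=
    HeisRing.map_units_inv_of_fixed (conjLocal L (IsCMField.complexConj L) v) a ha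
  have hainvv : Valued.v (((a⁻¹ : (LocalRing L v)ˣ) : LocalRing L v) w) = 1 := valued_units_inv_apply_eq_one L v hav
  set B : Set ↥(HeisRing.skewPart (conjLocal L (IsCMField.complexConj L) v)) :=
    {y | Valued.v ((y : LocalRing L v) w) ≤ Valued.v r} with hBdef
  -- the substitution is `μ⁻`-preserving (modulus one)
  set T := HeisRing.smulSkew (conjLocal L (IsCMField.complexConj L) v) (a⁻¹) hainvfix with hT
  obtain ⟨δ, hδ⟩ := exists_conjLocal_skew_unit L v
  have hmod : HeisRing.skewModulus (conjLocal L (IsCMField.complexConj L) v) hσc (a⁻¹) hainvfix = 1 := by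
    rw [HeisRing.skewModulus_eq_sqrt (conjLocal L (IsCMField.complexConj L) v) hσ hσc δ hδ (a⁻¹) hainvfix,
      show distribHaarChar (LocalRing L v) a⁻¹ = unitModulusChar (LocalRing L v) a⁻¹ from rfl,
      unitModulusChar_eq_one_of_forall_v_eq_one L v a⁻¹ (forall_placesOver_of_apply L v w hw hainvv), NNReal.sqrt_one]
  have hpres : MeasurePreserving T μY μY := by
    refine ⟨T.continuous.measurable, ?_⟩
    rw [hT, HeisRing.map_smulSkew_eq (conjLocal L (IsCMField.complexConj L) v) hσc (a⁻¹) hainvfix μY, hmod, inv_one, one_smul]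
  -- and it preserves the ball
  have hpre : T ⁻¹' B = B := by
    ext y
    rw [Set.mem_preimage, hBdef, Set.mem_setOf_eq, Set.mem_setOf_eq, hT, HeisRing.coe_smulSkew, Pi.mul_apply, map_mul, hainvv, one_mul]
  have key := hpres.setIntegral_preimage_emb T.toHomeomorph.measurableEmbedding F B
  rw [hpre] at key
  rw [← key]

/-! ## §3 THE LINE COSET LAW -/

open scoped Classical in
include hw in
/-- **THE LINE COSET LAW — `∫_{|y|_w ≤ r} E(â + g·y) dμ⁻ = E(â)·∫_{|y|_w ≤ r} E(1 + g·y) dμ⁻`** for a σ-FIXED unit `a` of modulus one (`|a_w| = 1`), EVERY direction `g : R` and EVERY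
radius `r` (P-WILD-1 v2 §2: the factorisation `U_E^{(m)} = (1 + 𝔭_F^{⌈m∕2⌉})·(1 + ℓ_m)` along a wild skew line `ℓ = g·R⁻` with the `F`-FACTOR `E(â) = ε₁(a)` RETAINED — `1` in
sub-branch (R-a), `ω_{E∕F}(a)` in (R-b)).  PROOF: `â + g·y = â·(1 + g·(â⁻¹y))` and §1 give `E(â + g·y) = E(â)·E(1 + g·(â⁻¹y))` pointwise (NO valuation hypothesis); §2 removes the
`â⁻¹`.  No `|2|_w = 1`, no `hfixP`, no trace-one element: ★ (5) §2 with its `χ₁ â = 1` step deleted. [cite: Keys1984, §4, §7 Theorem (2) p. 126] [cite: Serre1979, Ch. V §3]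
[cite: WeilBNT1967, Ch. II §5] -/
theorem setIntegral_skewBall_dite_units_add_mul_eq (χ₁ : (LocalRing L v)ˣ →* ℂˣ) (a : (LocalRing L v)ˣ)
    (ha : conjLocal L (IsCMField.complexConj L) v (a : LocalRing L v) = a) (hav : Valued.v ((a : LocalRing L v) w) = 1)
    (g : LocalRing L v) (r : w.1.adicCompletion L) :
    ∫ y in {y : ↥(HeisRing.skewPart (conjLocal L (IsCMField.complexConj L) v)) | Valued.v ((y : LocalRing L v) w) ≤ Valued.v r},
        (fun r : LocalRing L v => if h : IsUnit r then ((χ₁ h.unit : ℂˣ) : ℂ) else 0) ((a : LocalRing L v) + g * (y : LocalRing L v)) ∂μY =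
      ((χ₁ a : ℂˣ) : ℂ) *
        ∫ y in {y : ↥(HeisRing.skewPart (conjLocal L (IsCMField.complexConj L) v)) | Valued.v ((y : LocalRing L v) w) ≤ Valued.v r},
          (fun r : LocalRing L v => if h : IsUnit r then ((χ₁ h.unit : ℂˣ) : ℂ) else 0) (1 + g * (y : LocalRing L v)) ∂μY := by
  have hainvfix : conjLocal L (IsCMField.complexConj L) v (((a⁻¹ : (LocalRing L v)ˣ)) : LocalRing L v) = ((a⁻¹ : (LocalRing L v)ˣ) : LocalRing L v) :=
    HeisRing.map_units_inv_of_fixed (conjLocal L (IsCMField.complexConj L) v) a ha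
  -- (i) pointwise: `â + g·y = â·(1 + g·(â⁻¹y))`, then §1
  have hpt : ∀ y : ↥(HeisRing.skewPart (conjLocal L (IsCMField.complexConj L) v)),
      (fun r : LocalRing L v => if h : IsUnit r then ((χ₁ h.unit : ℂˣ) : ℂ) else 0) ((a : LocalRing L v) + g * (y : LocalRing L v)) =
        ((χ₁ a : ℂˣ) : ℂ) * (fun r : LocalRing L v => if h : IsUnit r then ((χ₁ h.unit : ℂˣ) : ℂ) else 0)
          (1 + g * ((HeisRing.smulSkew (conjLocal L (IsCMField.complexConj L) v) (a⁻¹) hainvfix y :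
            ↥(HeisRing.skewPart (conjLocal L (IsCMField.complexConj L) v))) : LocalRing L v)) := by
    intro y
    rw [HeisRing.coe_smulSkew, ← dite_units_mul_eq L v χ₁ a]
    congr 1
    rw [mul_add, mul_one, ← mul_assoc, mul_comm (a : LocalRing L v) g, mul_assoc, ← mul_assoc (a : LocalRing L v), Units.mul_inv, one_mul]
  simp_rw [hpt]
  rw [integral_const_mul]
  congr 1
  -- (ii) the substitution `y ↦ â⁻¹y`
  exact setIntegral_skewBall_comp_unitsInv_mul_eq L v w hw μY a ha hav
    (fun y => (fun r : LocalRing L v => if h : IsUnit r then ((χ₁ h.unit : ℂˣ) : ℂ) else 0) (1 + g * (y : LocalRing L v))) r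

end SkewBall

end Summit.HodgeConjecture.HodgeConjecture.R90.S1.WildLineCosetLaw

end
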